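import Mathlib.Data.ZMod.ValMinAbs
import Literature.Probability.LatticeModels.LatticeGraph

/-!
# Crux `AnchorGap` (stmt-QuantumFields-11141), line `registered` — chains spanning a separation are long

Geometry helper toward stub `stub_sgRepCore` of the skeleton `Cruxes/AnchorGap/Lines/birth.lean`
(the Peierls / sector estimates of the polymer representation on the discrete torus
`TorusSite 3 N = (ℤ/N)³`): a set `U` of torus sites which is CHAIN-CONNECTED for steps of
height `≤ R` in coordinate `0` and which touches both the slab `{x₀ ∈ [0, R₀]}` and the slab
`{x₀ ∈ [n, n + R₀]}` has at least `(n - R₀) / R` points: `n ≤ R · |U| + R₀`.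

Proof: measure the height of a site `x` by the circular distance `h x = |x₀ - u₀|_{ℤ/N}`
(`ZMod.valMinAbs`) from a site `u ∈ U` of the lower slab; `h u = 0`, `h v ≥ n - R₀` for a site
`v ∈ U` of the upper slab (both arcs from `u₀` to `v₀` are long since `N > 2n`), and `h` changes by
at most `R` along a step (triangle inequality for the circular distance).  The level `⌊h / R⌋`
then changes by at most `1` along a step, so by the discrete intermediate value property every
level `0, 1, …, ⌊h v / R⌋` is attained in `U`, whence `|U| ≥ ⌊h v / R⌋ + 1 > (n - R₀) / R`.
-/

set_option autoImplicit false

namespace Summit.QuantumFields.YangMills.Theorems.AnchorGap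

open Literature.Probability.LatticeModels

/-- **Discrete intermediate value property along a chain.** If a level function `q` increases by
at most `1` along a relation whose steps end in `U`, then along a chain from `a ∈ U` to `b` every
level between `q a` and `q b` is attained in `U`. [folklore] -/
theorem exists_mem_level_of_reflTransGen {β : Type*} {rel : β → β → Prop} {U : Finset β}
    {q : β → ℕ} (hU : ∀ x y, rel x y → y ∈ U) (hq : ∀ x y, rel x y → q y ≤ q x + 1) {a b : β}
    (ha : a ∈ U) (h : Relation.ReflTransGen rel a b) {m : ℕ} (ham : q a ≤ m) (hmb : m ≤ q b) :
    ∃ c ∈ U, q c = m := by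
  induction h generalizing m with
  | refl => exact ⟨a, ha, le_antisymm ham hmb⟩
  | @tail b c _ hbc ih =>
    by_cases hmb' : m ≤ q b
    · exact ih ham hmb'
    · have := hq b c hbc
      exact ⟨c, hU b c hbc, by omega⟩

/-- **Chains spanning a separation are long.** On the discrete torus `(ℤ/N)³` with `N > 2n`, let
`U` be a finite set of sites, chain-connected for the step relation "both endpoints in `U` and
coordinate-`0` heights differing by at most `R ≥ 1` (circularly)", containing a site `u` with
`u₀ ∈ [0, R₀]` and a site `v` with `v₀ ∈ [n, n + R₀]`.  Then `n ≤ R · |U| + R₀`: the circular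
distance `h = |x₀ - u₀|` is `0` at `u`, `≥ n - R₀` at `v` and `R`-Lipschitz along steps, so all the
levels `⌊h/R⌋ = 0, …, ⌊h v / R⌋` are attained in `U` (`exists_mem_level_of_reflTransGen`) and
`R · |U| ≥ R (⌊h v / R⌋ + 1) > h v ≥ n - R₀`. [folklore] -/
theorem torus_chain_card_lower_bound : ∀ (N : ℕ) [NeZero N] (R R₀ n : ℕ) (U : Finset (TorusSite 3 N)), 1 ≤ R → 2 * n < N → (∃ u ∈ U, (u 0).val ≤ R₀) → (∃ v ∈ U, (v 0 - (n : ZMod N)).val ≤ R₀) → (∀ u ∈ U, ∀ v ∈ U, Relation.ReflTransGen (fun x y : TorusSite 3 N => x ∈ U ∧ y ∈ U ∧ ((x 0 - y 0).val ≤ R ∨ (y 0 - x 0).val ≤ R)) u v) → n ≤ R * U.card + R₀ := by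
  intro N _ R R₀ n U hR hN hu hv hconn
  obtain ⟨u, huU, hu0⟩ := hu
  obtain ⟨v, hvU, hv0⟩ := hv
  -- trivial when `R₀ ≥ n`
  rcases Nat.lt_or_ge R₀ n with hR₀n | hnR
  swap
  · exact hnR.trans (Nat.le_add_left _ _)
  -- height: circular distance of coordinate `0` from `u 0`
  set h : TorusSite 3 N → ℕ := fun x => (x 0 - u 0).valMinAbs.natAbs with hhdef
  have hLip : ∀ x y : TorusSite 3 N, ((x 0 - y 0).val ≤ R ∨ (y 0 - x 0).val ≤ R) →
      h y ≤ h x + R := by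
    intro x y hxy
    have hstep : (y 0 - x 0).valMinAbs.natAbs ≤ R := by
      rcases hxy with hxy | hxy
      · rw [← neg_sub (x 0) (y 0), ZMod.natAbs_valMinAbs_neg, ZMod.valMinAbs_natAbs_eq_min]
        exact (min_le_left _ _).trans hxy
      · rw [ZMod.valMinAbs_natAbs_eq_min]
        exact (min_le_left _ _).trans hxy
    have heq : y 0 - u 0 = (x 0 - u 0) + (y 0 - x 0) := by ring
    calc h y = (y 0 - u 0).valMinAbs.natAbs := rfl
      _ ≤ ((x 0 - u 0).valMinAbs + (y 0 - x 0).valMinAbs).natAbs := by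
          rw [heq]
          exact ZMod.natAbs_valMinAbs_add_le _ _
      _ ≤ (x 0 - u 0).valMinAbs.natAbs + (y 0 - x 0).valMinAbs.natAbs := Int.natAbs_add_le _ _
      _ ≤ h x + R := Nat.add_le_add_left hstep _
  have hu_zero : h u = 0 := by
    simp [hhdef]
  -- the height of `v` is at least `n - R₀`
  have hv_ge : n - R₀ ≤ h v := by
    set s : ZMod N := u 0 with hsdef
    set t : ZMod N := v 0 - (n : ZMod N) with htdef
    have hs : s.val ≤ R₀ := hu0
    have ht : t.val ≤ R₀ := hv0
    have hlt : t.val + n - s.val < N := by omega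
    have hcast : v 0 - u 0 = ((t.val + n - s.val : ℕ) : ZMod N) := by
      rw [Nat.cast_sub (by omega), Nat.cast_add, ZMod.natCast_zmod_val, ZMod.natCast_zmod_val,
        htdef, hsdef]
      ring
    have hval : (v 0 - u 0).val = t.val + n - s.val := by
      rw [hcast, ZMod.val_natCast, Nat.mod_eq_of_lt hlt]
    have hhv : h v = min (v 0 - u 0).val (N - (v 0 - u 0).val) := ZMod.valMinAbs_natAbs_eq_min _
    rw [hhv, hval]
    omega
  -- levels `⌊h / R⌋` change by at most one along a step
  have hRpos : 0 < R := hR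
  set q : TorusSite 3 N → ℕ := fun x => h x / R with hqdef
  have hqLip : ∀ x y : TorusSite 3 N,
      (x ∈ U ∧ y ∈ U ∧ ((x 0 - y 0).val ≤ R ∨ (y 0 - x 0).val ≤ R)) → q y ≤ q x + 1 := by
    rintro x y ⟨-, -, hxy⟩
    calc q y = h y / R := rfl
      _ ≤ (h x + R) / R := Nat.div_le_div_right (hLip x y hxy)
      _ = h x / R + 1 := Nat.add_div_right _ hRpos
  have hqu : q u = 0 := by
    simp [hqdef, hu_zero]
  -- every level `0, …, q v` is attained in `U`
  have hlev : ∀ m, m ≤ q v → ∃ c ∈ U, q c = m := fun m hm =>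
    exists_mem_level_of_reflTransGen (fun _ _ hxy => hxy.2.1) hqLip huU (hconn u huU v hvU)
      (by rw [hqu]; exact Nat.zero_le _) hm
  have hcard : q v + 1 ≤ U.card := by
    calc q v + 1 = (Finset.range (q v + 1)).card := (Finset.card_range _).symm
      _ ≤ (U.image q).card := by
          refine Finset.card_le_card fun m hm => ?_
          obtain ⟨c, hc, hcm⟩ := hlev m (Nat.lt_succ_iff.1 (Finset.mem_range.1 hm))
          exact Finset.mem_image.2 ⟨c, hc, hcm⟩
      _ ≤ U.card := Finset.card_image_le
  -- arithmetic: `n - R₀ ≤ h v < R (q v + 1) ≤ R |U|`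
  have h1 : h v < R * (q v + 1) := by
    have hdm := Nat.div_add_mod (h v) R
    have hml := Nat.mod_lt (h v) hRpos
    have hq : q v = h v / R := rfl
    rw [hq, mul_add, mul_one]
    omega
  have h2 : R * (q v + 1) ≤ R * U.card := Nat.mul_le_mul_left _ hcard
  omega

end Summit.QuantumFields.YangMills.Theorems.AnchorGap
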